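import Literature.AlgebraicGeometry.Motives.HodgeGroupOfOrientationMinusIdentity
import Literature.AlgebraicGeometry.Motives.MumfordTateGroupOfInducedOrientation
import HarnessLib

/-!
# `−id ∈ M_φ` is an invariant of induction: for `Π = Π′^F` induced from `(F′,Π′)`, `−id ∈ M_φ(V^n_{(F,Π)}) ⟺ −id ∈ M_φ(V^n_{(F′,Π′)})`
# (balanced vectors push forward and lift along restriction of embeddings, preserving the mass)

[topic AlgebraicGeometry/Motives]

Layer `Literature/AlgebraicGeometry/Motives`, lane `lit-hodgefound` (Track 2 foundations library; seat `lit-hodgefound-p02`, gen 29, row g29-#8).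
THEOREMS ONLY (no definition, no named fact; D-0026 net debt `0`).  g29-#1 `Motives/HodgeGroupOfOrientationMinusIdentity`: `−id ∈ M_φ(V^n_{(F,Π)})` iff every
orientation-balanced integer vector (`2 Σ_σ m_σ deg(τ•σ) = n Σ_σ m_σ` for all `τ ∈ Aut(ℂ)`) has even mass `Σ_σ m_σ`.  g27-#16
`Motives/MumfordTateGroupOfInducedOrientation`: for an orientation `Π = Π′^F` INDUCED along `k : F′ → F` (`deg θ = deg′(θ ∘ k)`, g23 `Orientation.induced`; GGK
(V.A.1)(ii),(iv): «`(K,Υ)` is a subOIF of `(F,Π)` iff `K ⊆ F` is a subfield and `Υ = Π|_K`») the Mumford–Tate and Hodge groups of `V^n_{(F,Π)} ≅ (V^n_{(F′,Π′)})^{⊕[F:F′]}`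
and of `V^n_{(F′,Π′)}` are abstractly isomorphic («if a SCMpHS has a sub-Hodge structure then they will have the same Mumford–Tate group», §V.D p. 164).  This file
adds the one piece of that comparison which the abstract isomorphism does not see: the position of the homothety `−id`.  §1: balanced vectors PUSH FORWARD along
restriction of embeddings `res : Hom(F,ℂ) → Hom(F′,ℂ)` (`m ↦ (θ′ ↦ Σ_{θ|θ′} m_θ)`, same mass) and LIFT along any section of `res` (same mass); §2: hence a balanced vector
of odd mass exists for `Π` iff one exists for `Π′`, and (§3) **`−id ∈ M_φ(V^n_{(F,Π)})(ℂ) ⟺ −id ∈ M_φ(V^n_{(F′,Π′)})(ℂ)`** (also on `ℝ`- and `ℚ`-points, and for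
`Λ.IsInducedFrom K₀` with the restricted orientation): the even-weight sign defect of g29-#3 lives on the primitive core `(F″, Π″)`.

THE PRINTS.  [GreenGriffithsKerr2012] (V.A.1) (ii),(iv) p0155; §V.D p0164 («same Mumford–Tate group»), (V.D.5) p0164; [Deligne1982HodgeCycles] I Example 3.7 (c),(d)
(products / the torus of a CM type and its characters).  (READING NOTE, proved.)

WHAT IS PROVED (`k : F′ →+* F` number fields, `Λ′ : Orientation F′ n`).
* §1 `exists_comp_eq` (every `θ′ : F′ → ℂ` extends along `k`), `sum_mul_comp_eq_sum_fiber_mul`, **`balanced_fiberSum_of_balanced_induced`** + `sum_fiberSum`,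
  **`balanced_sectionLift_of_balanced`** + `sum_sectionLift`.
* §2 **`exists_balanced_odd_sum_induced_iff`**, `forall_balanced_even_sum_induced_iff`.
* §3 **`smulOfUnit_neg_one_mem_hodgeGroupBaseChange_complex_ofOrientation_induced_iff`**, `…_real_…`, `smulOfUnit_neg_one_mem_hodgeGroup_ofOrientation_induced_iff`,
  `smulOfUnit_neg_one_mem_hodgeGroupBaseChange_complex_ofOrientation_iff_restrict` (`Λ.IsInducedFrom K₀`).

HONEST SCOPE.  Pure bookkeeping on g29-#1's criterion; no explicit isomorphism `M_φ(V) ≅ M_φ(V′)` carrying `−id` to `−id` is constructed (the tree's comparison is an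
abstract `≃*` of split tori).

## References
* [GreenGriffithsKerr2012] M. Green, P. Griffiths, M. Kerr, *Mumford–Tate Groups and Domains* (2012) — (V.A.1) p. 155; §V.D p. 164, (V.D.5); §I.B p. 35.
* [Deligne1982HodgeCycles] P. Deligne, *Hodge cycles on abelian varieties*, in LNM 900 (1982) — I Example 3.7 (c), (d).

## Provenance
Lane `lit-hodgefound` (Hodge path, Track 2), prover seat `lit-hodgefound-p02` (generation 29), self-proposed row g29-#8.
-/

noncomputable section

open scoped TensorProduct Classical
open Module NumberField

namespace Literature.AlgebraicGeometry.Motives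

namespace HodgeStructure

open Orientation Literature.NumberTheory.ComplexMultiplication

/-! ### §1 Push-forward and lift of balanced vectors along restriction of embeddings -/

section Transfer

variable {F F' : Type} [Field F] [NumberField F] [Field F'] [NumberField F'] {n : ℤ} (k : F' →+* F) (Λ' : Orientation F' n)

/-- Every complex embedding of `F′` extends along `k : F′ → F` (`Aut(ℂ)` is transitive on `Hom(F′,ℂ)`, and `Hom(F,ℂ) ≠ ∅`). [cite: GreenGriffithsKerr2012, (V.A.1) (ii) p. 155] -/
theorem exists_comp_eq (σ₀ : F' →+* ℂ) : ∃ σ : F →+* ℂ, σ.comp k = σ₀ := by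
  obtain ⟨σ₁⟩ : Nonempty (F →+* ℂ) := inferInstance
  haveI := Literature.AlgebraicGeometry.Pohlmann1968.isPretransitive_ringEquiv_complex (K := F')
  obtain ⟨τ, hτ⟩ := MulAction.exists_smul_eq (ℂ ≃+* ℂ) (σ₁.comp k) σ₀
  refine ⟨τ.toRingHom.comp σ₁, ?_⟩
  rw [RingHom.comp_assoc, ← ringEquiv_smul_def]
  exact hτ

omit [NumberField F] [NumberField F'] in
/-- Restriction of embeddings is `Aut(ℂ)`-equivariant: `(τ•θ) ∘ k = τ•(θ ∘ k)`. [cite: GreenGriffithsKerr2012, (V.A.1) (ii) p. 155] -/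
theorem smul_comp_eq (τ : ℂ ≃+* ℂ) (θ : F →+* ℂ) : (τ • θ).comp k = τ • θ.comp k := by
  rw [ringEquiv_smul_def, ringEquiv_smul_def, RingHom.comp_assoc]

/-- **Summation along the fibres of restriction**: `Σ_θ m_θ · g(θ ∘ k) = Σ_{θ′} (Σ_{θ | θ∘k = θ′} m_θ) · g(θ′)`. [cite: Deligne1982HodgeCycles, I Example 3.7 (c)] -/
theorem sum_mul_comp_eq_sum_fiber_mul (m : (F →+* ℂ) → ℤ) (g : (F' →+* ℂ) → ℤ) :
    ∑ θ : F →+* ℂ, m θ * g (θ.comp k) =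
      ∑ θ' : F' →+* ℂ, (∑ θ ∈ Finset.univ.filter (fun θ : F →+* ℂ => θ.comp k = θ'), m θ) * g θ' := by
  rw [← Finset.sum_fiberwise Finset.univ (fun θ : F →+* ℂ => θ.comp k) (fun θ => m θ * g (θ.comp k))]
  refine Finset.sum_congr rfl fun θ' _ => ?_
  rw [Finset.sum_mul]
  refine Finset.sum_congr rfl fun θ hθ => ?_
  rw [(Finset.mem_filter.1 hθ).2]

/-- **The fibre sum has the same mass.** [cite: Deligne1982HodgeCycles, I Example 3.7 (c)] -/
theorem sum_fiberSum (m : (F →+* ℂ) → ℤ) :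
    ∑ θ' : F' →+* ℂ, (∑ θ ∈ Finset.univ.filter (fun θ : F →+* ℂ => θ.comp k = θ'), m θ) = ∑ θ : F →+* ℂ, m θ := by
  have h := sum_mul_comp_eq_sum_fiber_mul k m (fun _ => 1)
  simp only [mul_one] at h
  exact h.symm

/-- **Balanced vectors push forward**: if `m` is balanced for the induced orientation `Π′^F` then its fibre sum `θ′ ↦ Σ_{θ|θ′} m_θ` is balanced for `Π′`.
[cite: GreenGriffithsKerr2012, (V.A.1) (ii) p. 155 and §V.D p. 164] [cite: Deligne1982HodgeCycles, I Example 3.7 (c)] -/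
theorem balanced_fiberSum_of_balanced_induced (m : (F →+* ℂ) → ℤ)
    (hm : ∀ τ : ℂ ≃+* ℂ, 2 * ∑ θ, m θ * (Λ'.induced k).deg (τ • θ) = n * ∑ θ, m θ) (τ : ℂ ≃+* ℂ) :
    2 * ∑ θ' : F' →+* ℂ, (∑ θ ∈ Finset.univ.filter (fun θ : F →+* ℂ => θ.comp k = θ'), m θ) * Λ'.deg (τ • θ') =
      n * ∑ θ' : F' →+* ℂ, (∑ θ ∈ Finset.univ.filter (fun θ : F →+* ℂ => θ.comp k = θ'), m θ) := by
  have h1 := hm τ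
  simp only [induced_deg, smul_comp_eq] at h1
  rw [sum_mul_comp_eq_sum_fiber_mul k m (fun θ' => Λ'.deg (τ • θ'))] at h1
  rw [h1, sum_fiberSum]

/-- **Summation over a section**: for `s` a section of restriction (`s(θ′) ∘ k = θ′`), the vector supported on `s(Hom(F′,ℂ))` with values `m′` sums like `m′`:
`Σ_θ [θ = s(θ∘k)] m′(θ∘k) g(θ∘k) = Σ_{θ′} m′_{θ′} g(θ′)`. [cite: Deligne1982HodgeCycles, I Example 3.7 (c)] -/
theorem sum_sectionLift_mul {s : (F' →+* ℂ) → (F →+* ℂ)} (hs : ∀ θ', (s θ').comp k = θ') (m' g : (F' →+* ℂ) → ℤ) :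
    ∑ θ : F →+* ℂ, (if θ = s (θ.comp k) then m' (θ.comp k) else 0) * g (θ.comp k) = ∑ θ' : F' →+* ℂ, m' θ' * g θ' := by
  have hinj : Function.Injective s := fun a b h => by rw [← hs a, ← hs b, h]
  have hfilter : (Finset.univ.filter fun θ : F →+* ℂ => θ = s (θ.comp k)) = Finset.univ.image s := by
    ext θ
    simp only [Finset.mem_filter, Finset.mem_univ, true_and, Finset.mem_image]
    constructor
    · intro h
      exact ⟨θ.comp k, h.symm⟩
    · rintro ⟨θ', rfl⟩
      rw [hs]
  simp only [ite_mul, zero_mul]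
  rw [← Finset.sum_filter, hfilter, Finset.sum_image fun a _ b _ h => hinj h]
  simp only [hs]

/-- The section lift has the same mass. [cite: Deligne1982HodgeCycles, I Example 3.7 (c)] -/
theorem sum_sectionLift {s : (F' →+* ℂ) → (F →+* ℂ)} (hs : ∀ θ', (s θ').comp k = θ') (m' : (F' →+* ℂ) → ℤ) :
    ∑ θ : F →+* ℂ, (if θ = s (θ.comp k) then m' (θ.comp k) else 0) = ∑ θ' : F' →+* ℂ, m' θ' := by
  have h := sum_sectionLift_mul k hs m' (fun _ => 1)
  simp only [mul_one] at h
  exact h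

/-- **Balanced vectors lift**: if `m′` is balanced for `Π′` then its lift along a section `s` of restriction is balanced for the induced orientation `Π′^F`.
[cite: GreenGriffithsKerr2012, (V.A.1) (ii) p. 155 and §V.D p. 164] [cite: Deligne1982HodgeCycles, I Example 3.7 (c)] -/
theorem balanced_sectionLift_of_balanced {s : (F' →+* ℂ) → (F →+* ℂ)} (hs : ∀ θ', (s θ').comp k = θ') (m' : (F' →+* ℂ) → ℤ)
    (hm' : ∀ τ : ℂ ≃+* ℂ, 2 * ∑ θ', m' θ' * Λ'.deg (τ • θ') = n * ∑ θ', m' θ') (τ : ℂ ≃+* ℂ) :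
    2 * ∑ θ : F →+* ℂ, (if θ = s (θ.comp k) then m' (θ.comp k) else 0) * (Λ'.induced k).deg (τ • θ) =
      n * ∑ θ : F →+* ℂ, (if θ = s (θ.comp k) then m' (θ.comp k) else 0) := by
  simp only [induced_deg, smul_comp_eq]
  rw [sum_sectionLift_mul k hs m' (fun θ' => Λ'.deg (τ • θ')), sum_sectionLift k hs m']
  exact hm' τ

/-! ### §2 Odd balanced masses exist for `Π′^F` iff they exist for `Π′` -/

/-- **A balanced vector of odd mass exists for the induced orientation iff one exists for `Π′`.** [cite: GreenGriffithsKerr2012, §V.D p. 164]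
[cite: Deligne1982HodgeCycles, I Example 3.7 (c), (d)] -/
theorem exists_balanced_odd_sum_induced_iff :
    (∃ m : (F →+* ℂ) → ℤ, (∀ τ : ℂ ≃+* ℂ, 2 * ∑ θ, m θ * (Λ'.induced k).deg (τ • θ) = n * ∑ θ, m θ) ∧ Odd (∑ θ, m θ)) ↔
      ∃ m' : (F' →+* ℂ) → ℤ, (∀ τ : ℂ ≃+* ℂ, 2 * ∑ θ', m' θ' * Λ'.deg (τ • θ') = n * ∑ θ', m' θ') ∧ Odd (∑ θ', m' θ') := by
  constructor
  · rintro ⟨m, hm, hodd⟩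
    exact ⟨_, balanced_fiberSum_of_balanced_induced k Λ' m hm, by rwa [sum_fiberSum]⟩
  · rintro ⟨m', hm', hodd⟩
    have hs : ∀ θ' : F' →+* ℂ, (Classical.choose (exists_comp_eq k θ')).comp k = θ' := fun θ' => Classical.choose_spec (exists_comp_eq k θ')
    exact ⟨_, balanced_sectionLift_of_balanced k Λ' hs m' hm', by rwa [sum_sectionLift k hs]⟩

/-- Equivalently: every balanced vector has even mass for `Π′^F` iff the same holds for `Π′`. [cite: GreenGriffithsKerr2012, §V.D p. 164] -/
theorem forall_balanced_even_sum_induced_iff :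
    (∀ m : (F →+* ℂ) → ℤ, (∀ τ : ℂ ≃+* ℂ, 2 * ∑ θ, m θ * (Λ'.induced k).deg (τ • θ) = n * ∑ θ, m θ) → Even (∑ θ, m θ)) ↔
      ∀ m' : (F' →+* ℂ) → ℤ, (∀ τ : ℂ ≃+* ℂ, 2 * ∑ θ', m' θ' * Λ'.deg (τ • θ') = n * ∑ θ', m' θ') → Even (∑ θ', m' θ') := by
  have h := exists_balanced_odd_sum_induced_iff k Λ'
  constructor
  · intro hF m' hm'
    by_contra hodd
    rw [Int.not_even_iff_odd] at hodd
    obtain ⟨m, hm, hm2⟩ := h.2 ⟨m', hm', hodd⟩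
    exact (Int.not_even_iff_odd.2 hm2) (hF m hm)
  · intro hF' m hm
    by_contra hodd
    rw [Int.not_even_iff_odd] at hodd
    obtain ⟨m', hm', hm2⟩ := h.1 ⟨m, hm, hodd⟩
    exact (Int.not_even_iff_odd.2 hm2) (hF' m' hm')

/-! ### §3 `−id ∈ M_φ` transfers along induction -/

variable [HodgeTensorFacts.{0, 0}]

/-- **`−id ∈ M_φ(V^n_{(F,Π′^F)})(ℂ) ⟺ −id ∈ M_φ(V^n_{(F′,Π′)})(ℂ)`** (g29-#1's parity criterion on both sides + §2). [cite: GreenGriffithsKerr2012, §V.D p. 164 and §I.B p. 35]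
[cite: Deligne1982HodgeCycles, I Example 3.7 (c), (d)] -/
theorem smulOfUnit_neg_one_mem_hodgeGroupBaseChange_complex_ofOrientation_induced_iff :
    (LinearEquiv.smulOfUnit (-1 : ℂˣ) : (ℂ ⊗[ℚ] F) ≃ₗ[ℂ] (ℂ ⊗[ℚ] F)) ∈ (ofOrientation (Λ'.induced k)).hodgeGroupBaseChange ℂ ↔
      (LinearEquiv.smulOfUnit (-1 : ℂˣ) : (ℂ ⊗[ℚ] F') ≃ₗ[ℂ] (ℂ ⊗[ℚ] F')) ∈ (ofOrientation Λ').hodgeGroupBaseChange ℂ := by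
  rw [smulOfUnit_neg_one_mem_hodgeGroupBaseChange_complex_ofOrientation_iff, smulOfUnit_neg_one_mem_hodgeGroupBaseChange_complex_ofOrientation_iff,
    forall_balanced_even_sum_induced_iff]

/-- The same on `ℝ`-points. [cite: GreenGriffithsKerr2012, §V.D p. 164 and §I.B p. 35] -/
theorem smulOfUnit_neg_one_mem_hodgeGroupBaseChange_real_ofOrientation_induced_iff :
    (LinearEquiv.smulOfUnit (-1 : ℝˣ) : (ℝ ⊗[ℚ] F) ≃ₗ[ℝ] (ℝ ⊗[ℚ] F)) ∈ (ofOrientation (Λ'.induced k)).hodgeGroupBaseChange ℝ ↔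
      (LinearEquiv.smulOfUnit (-1 : ℝˣ) : (ℝ ⊗[ℚ] F') ≃ₗ[ℝ] (ℝ ⊗[ℚ] F')) ∈ (ofOrientation Λ').hodgeGroupBaseChange ℝ := by
  rw [smulOfUnit_neg_one_mem_hodgeGroupBaseChange_real_ofOrientation_iff, smulOfUnit_neg_one_mem_hodgeGroupBaseChange_real_ofOrientation_iff,
    forall_balanced_even_sum_induced_iff]

/-- The same on `ℚ`-points. [cite: GreenGriffithsKerr2012, §V.D p. 164 and §I.B p. 35] -/
theorem smulOfUnit_neg_one_mem_hodgeGroup_ofOrientation_induced_iff :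
    (LinearEquiv.smulOfUnit (-1 : ℚˣ) : F ≃ₗ[ℚ] F) ∈ (ofOrientation (Λ'.induced k)).hodgeGroup ↔
      (LinearEquiv.smulOfUnit (-1 : ℚˣ) : F' ≃ₗ[ℚ] F') ∈ (ofOrientation Λ').hodgeGroup := by
  rw [smulOfUnit_neg_one_mem_hodgeGroup_ofOrientation_iff, smulOfUnit_neg_one_mem_hodgeGroup_ofOrientation_iff, forall_balanced_even_sum_induced_iff]

end Transfer

section Restrict

variable {F : Type} [Field F] [NumberField F] {n : ℤ} (Λ : Orientation F n) (K₀ : IntermediateField ℚ F) [HodgeTensorFacts.{0, 0}]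

/-- **For `Π` induced from the subfield `K₀`: `−id ∈ M_φ(V^n_{(F,Π)})(ℂ) ⟺ −id ∈ M_φ(V^n_{(K₀,Π|_{K₀})})(ℂ)`** (g23 `Orientation.restrict`, `induced_restrict`). So the
even-weight sign defect is read on the primitive core `(F″,Π″)`. [cite: GreenGriffithsKerr2012, (V.A.1) (iv) p. 155 and §V.D p. 164] -/
theorem smulOfUnit_neg_one_mem_hodgeGroupBaseChange_complex_ofOrientation_iff_restrict (h : Λ.IsInducedFrom K₀) :
    (LinearEquiv.smulOfUnit (-1 : ℂˣ) : (ℂ ⊗[ℚ] F) ≃ₗ[ℂ] (ℂ ⊗[ℚ] F)) ∈ (ofOrientation Λ).hodgeGroupBaseChange ℂ ↔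
      (LinearEquiv.smulOfUnit (-1 : ℂˣ) : (ℂ ⊗[ℚ] K₀) ≃ₗ[ℂ] (ℂ ⊗[ℚ] K₀)) ∈ (ofOrientation (Λ.restrict K₀ h)).hodgeGroupBaseChange ℂ := by
  conv_lhs => rw [← induced_restrict Λ h]
  exact smulOfUnit_neg_one_mem_hodgeGroupBaseChange_complex_ofOrientation_induced_iff (algebraMap K₀ F) (Λ.restrict K₀ h)

end Restrict

end HodgeStructure

end Literature.AlgebraicGeometry.Motives

end
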